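import Literature.Analysis.Complex.RectangleResidueSimplePoles
import Mathlib.MeasureTheory.Integral.IntegralEqImproper
import Mathlib.MeasureTheory.Group.Integral
import Mathlib.Analysis.SpecialFunctions.Trigonometric.Basic
import HarnessLib

/-!
# Residue theorem between two parallel lines (horizontal, or of slope one)

Trunk T-ANALYSIS support (`Literature/Analysis/Complex`). The tree has the residue theorem for a
rectangle with finitely many simple poles
(`Literature.Analysis.Complex.rectBoundaryIntegral_eq_sum_of_simplePoles`) and the pole-free shift of
a vertical line of integration (`Literature.Analysis.Complex.integral_vertical_eq_of_differentiableOn`).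
This file lets the rectangle `[-T, T] × [y₁, y₂]` tend to the whole strip:

* `Literature.Analysis.Complex.integral_horizontal_sub_eq_sum_of_simplePoles` — for `F` meromorphic on a
  neighbourhood of the closed strip `y₁ ≤ im w ≤ y₂` with finitely many simple poles in the open strip,
  absolutely integrable along both boundary lines and uniformly small on the cross-sections
  `re w = ±T` as `T → ∞`:  `∫ F(x + y₁ i) dx − ∫ F(x + y₂ i) dx = 2πi Σ res`.
* `Literature.Analysis.Complex.integral_slant_sub_eq_sum_of_simplePoles` — the same between the two lines
  of slope one through the real points `c₁ < c₂`, parametrised as `u ↦ c + u(1+i)` (the rotation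
  `w ↦ (1+i)w` maps the horizontal line `im w = -c/2` onto the line through `c`):
  `∫ f(c₂ + u(1+i)) du − ∫ f(c₁ + u(1+i)) du = (2πi/(1+i)) Σ res`.
* `Literature.Analysis.Complex.integral_slant_div_sin_sub_eq_sum` — the case `f = h / sin(π·)` with `h`
  holomorphic near the strip and `c₁, c₂ ∉ ℤ`: the poles are the integers `n ∈ (c₁, c₂)` with
  residues `(-1)ⁿ h(n)/π`, so `∫_{c₂} − ∫_{c₁} = (2i/(1+i)) Σ_{c₁<n<c₂} (-1)ⁿ h(n)`.

These are the contour moves behind Riemann's/Siegel's treatment of the integrals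
`∫ e^{±πix²+2πiux}/(e^{πix} − e^{−πix}) dx` along lines of slope `±1` (C. L. Siegel, *Über Riemanns
Nachlaß zur analytischen Zahlentheorie*, 1932, §1 and §3; E. C. Titchmarsh, *The Theory of the
Riemann Zeta-Function*, §2.10), used in `Literature/NumberTheory/LFunctions/` for the Riemann–Siegel
integral formula. Standard textbook material; tagged folklore.
-/

noncomputable section

open _root_.Complex Set MeasureTheory Filter intervalIntegral Real
open scoped _root_.Topology

namespace Literature.Analysis.Complex

/-! ### Horizontal strip -/

/-- **Residue theorem for a horizontal strip.** Let `y₁ < y₂`, `U ⊇ {y₁ ≤ im w ≤ y₂}` open,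
`S` a finite set of points of the open strip, `F` complex differentiable on `U ∖ S` with a simple
pole at each `p ∈ S` in the concrete sense `F(z) = φ_p(z)/(z − p)` near `p` (`φ_p` differentiable
near `p`, `φ_p(p) = r(p)`). If `F` is integrable along `im w = y₁` and `im w = y₂` and
`sup_{y ∈ [y₁,y₂]} ‖F(T + yi)‖ → 0` as `|T| → ∞`, then
`∫ F(x + y₁ i) dx − ∫ F(x + y₂ i) dx = 2πi Σ_{p ∈ S} r(p)` (lower line minus upper line: the
positively oriented boundary of the strip). [folklore] -/
theorem integral_horizontal_sub_eq_sum_of_simplePoles {F : ℂ → ℂ} {y₁ y₂ : ℝ} (hy : y₁ < y₂)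
    (S : Finset ℂ) (r : ℂ → ℂ) (U : Set ℂ) (hU : IsOpen U)
    (hKU : im ⁻¹' Icc y₁ y₂ ⊆ U) (hS : ∀ p ∈ S, p.im ∈ Ioo y₁ y₂)
    (hF : DifferentiableOn ℂ F (U \ ↑S))
    (hpole : ∀ p ∈ S, ∃ φ : ℂ → ℂ, ∃ V ∈ 𝓝 p, DifferentiableOn ℂ φ V ∧ φ p = r p ∧
        ∀ z ∈ V, z ≠ p → F z = φ z / (z - p))
    (h₁ : Integrable fun x : ℝ ↦ F (x + y₁ * I)) (h₂ : Integrable fun x : ℝ ↦ F (x + y₂ * I))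
    (hdecay : ∀ ε : ℝ, 0 < ε → ∃ T₀ : ℝ, ∀ T : ℝ, T₀ ≤ |T| → ∀ y ∈ Icc y₁ y₂,
        ‖F (T + y * I)‖ ≤ ε) :
    (∫ x : ℝ, F (x + y₁ * I)) - ∫ x : ℝ, F (x + y₂ * I) = 2 * π * I * ∑ p ∈ S, r p := by
  classical
  -- all poles have `|re p| < R`
  set R : ℝ := ∑ p ∈ S, |p.re| + 1 with hRdef
  have hsum0 : 0 ≤ ∑ p ∈ S, |p.re| := Finset.sum_nonneg fun q _ ↦ abs_nonneg _
  have hR0 : 0 < R := by rw [hRdef]; linarith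
  have hR : ∀ p ∈ S, |p.re| < R := fun p hp ↦ by
    have : |p.re| ≤ ∑ q ∈ S, |q.re| :=
      Finset.single_le_sum (f := fun q ↦ |q.re|) (fun q _ ↦ abs_nonneg _) hp
    rw [hRdef]; linarith
  -- the rectangle identity for `T ≥ R`
  have hrect : ∀ T : ℝ, R ≤ T →
      rectBoundaryIntegral F (-T) T y₁ y₂ = 2 * π * I * ∑ p ∈ S, r p := by
    intro T hT
    have hT0 : 0 < T := hR0.trans_le hT
    refine rectBoundaryIntegral_eq_sum_of_simplePoles (by linarith) hy S F r U hU ?_ ?_ hF hpole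
    · intro z hz
      rw [mem_reProdIm] at hz
      exact hKU hz.2
    · intro p hp
      rw [mem_reProdIm]
      have h := hR p (by exact_mod_cast hp)
      rw [abs_lt] at h
      exact ⟨⟨by linarith, by linarith⟩, hS p (by exact_mod_cast hp)⟩
  -- the horizontal sides converge to the full line integrals
  have hbot : Tendsto (fun T : ℝ ↦ ∫ x in (-T)..T, F (x + y₁ * I)) atTop
      (𝓝 (∫ x : ℝ, F (x + y₁ * I))) :=
    intervalIntegral_tendsto_integral h₁ tendsto_neg_atTop_atBot tendsto_id
  have htop : Tendsto (fun T : ℝ ↦ ∫ x in (-T)..T, F (x + y₂ * I)) atTop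
      (𝓝 (∫ x : ℝ, F (x + y₂ * I))) :=
    intervalIntegral_tendsto_integral h₂ tendsto_neg_atTop_atBot tendsto_id
  -- the vertical sides tend to zero
  have hvert : Tendsto (fun T : ℝ ↦ I * (∫ y in y₁..y₂, F (T + y * I))
      - I * (∫ y in y₁..y₂, F (((-T : ℝ) : ℂ) + y * I))) atTop (𝓝 0) := by
    rw [Metric.tendsto_atTop]
    intro ε hε
    set ε' : ℝ := ε / (2 * (y₂ - y₁) + 1) with hε'
    have hba : 0 ≤ y₂ - y₁ := by linarith
    have hε'0 : 0 < ε' := div_pos hε (by positivity)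
    obtain ⟨T₀, hT₀⟩ := hdecay ε' hε'0
    refine ⟨max T₀ 0, fun T hT ↦ ?_⟩
    have hT0 : 0 ≤ T := le_of_max_le_right hT
    have hTabs : T₀ ≤ |T| := by rw [abs_of_nonneg hT0]; exact le_of_max_le_left hT
    have hTabs' : T₀ ≤ |(-T)| := by rwa [abs_neg]
    have hr : ‖∫ y in y₁..y₂, F (T + y * I)‖ ≤ ε' * |y₂ - y₁| :=
      norm_integral_le_of_norm_le_const fun y hyy ↦
        hT₀ T hTabs y (by rw [uIoc_of_le hy.le] at hyy; exact ⟨hyy.1.le, hyy.2⟩)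
    have hl : ‖∫ y in y₁..y₂, F (((-T : ℝ) : ℂ) + y * I)‖ ≤ ε' * |y₂ - y₁| :=
      norm_integral_le_of_norm_le_const fun y hyy ↦
        hT₀ (-T) hTabs' y (by rw [uIoc_of_le hy.le] at hyy; exact ⟨hyy.1.le, hyy.2⟩)
    rw [abs_of_nonneg hba] at hr hl
    rw [dist_zero_right, ← mul_sub, norm_mul, Complex.norm_I, one_mul]
    calc ‖(∫ y in y₁..y₂, F (T + y * I)) - ∫ y in y₁..y₂, F (((-T : ℝ) : ℂ) + y * I)‖
        ≤ ε' * (y₂ - y₁) + ε' * (y₂ - y₁) := (norm_sub_le _ _).trans (add_le_add hr hl)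
      _ < ε := by
          have : ε' * (2 * (y₂ - y₁) + 1) = ε := by rw [hε']; field_simp
          nlinarith
  -- assemble the limit of the rectangle integrals
  have hlim : Tendsto (fun T : ℝ ↦ rectBoundaryIntegral F (-T) T y₁ y₂) atTop
      (𝓝 ((∫ x : ℝ, F (x + y₁ * I)) - (∫ x : ℝ, F (x + y₂ * I)) + 0)) := by
    refine ((hbot.sub htop).add hvert).congr' (Eventually.of_forall fun T ↦ ?_)
    simp only [rectBoundaryIntegral]
    ring
  have hconst : Tendsto (fun T : ℝ ↦ rectBoundaryIntegral F (-T) T y₁ y₂) atTop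
      (𝓝 (2 * π * I * ∑ p ∈ S, r p)) := by
    refine tendsto_const_nhds.congr' ?_
    filter_upwards [eventually_ge_atTop R] with T hT
    exact (hrect T hT).symm
  have h := tendsto_nhds_unique hlim hconst
  rwa [add_zero] at h

/-- **Pole-free horizontal shift.** If `F` is complex differentiable on a neighbourhood of the
closed strip `y₁ ≤ im w ≤ y₂`, integrable along both boundary lines and uniformly small on the
cross-sections `re w = ±T` as `|T| → ∞`, then `∫ F(x + y₁ i) dx = ∫ F(x + y₂ i) dx`. [folklore] -/
theorem integral_horizontal_eq_of_differentiableOn {F : ℂ → ℂ} {y₁ y₂ : ℝ} (hy : y₁ ≤ y₂)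
    (U : Set ℂ) (hU : IsOpen U) (hKU : im ⁻¹' Icc y₁ y₂ ⊆ U) (hF : DifferentiableOn ℂ F U)
    (h₁ : Integrable fun x : ℝ ↦ F (x + y₁ * I)) (h₂ : Integrable fun x : ℝ ↦ F (x + y₂ * I))
    (hdecay : ∀ ε : ℝ, 0 < ε → ∃ T₀ : ℝ, ∀ T : ℝ, T₀ ≤ |T| → ∀ y ∈ Icc y₁ y₂,
        ‖F (T + y * I)‖ ≤ ε) :
    ∫ x : ℝ, F (x + y₁ * I) = ∫ x : ℝ, F (x + y₂ * I) := by
  rcases hy.eq_or_lt with rfl | hy'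
  · rfl
  have h := integral_horizontal_sub_eq_sum_of_simplePoles hy' ∅ (fun _ ↦ 0) U hU hKU
    (by simp) (by simpa using hF) (by simp) h₁ h₂ hdecay
  simp only [Finset.sum_empty, mul_zero] at h
  exact sub_eq_zero.1 h

/-! ### Lines of slope one -/

/-- The rotation `w ↦ (1+i)w` maps the horizontal line `im w = y` onto the line of slope one through
the real point `-2y`: `(1+i)(x + yi) = (-2y) + (x + y)(1+i)`. [folklore] -/
lemma one_add_I_mul_ofReal_add_mul_I (x y : ℝ) :
    (1 + I) * ((x : ℂ) + y * I) = ((-2 * y : ℝ) : ℂ) + ((x + y : ℝ) : ℂ) * (1 + I) := by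
  apply Complex.ext <;> simp <;> ring

/-- `re ((1+i)w) − im ((1+i)w) = −2 im w`. [folklore] -/
lemma re_sub_im_one_add_I_mul (w : ℂ) : ((1 + I) * w).re - ((1 + I) * w).im = -2 * w.im := by
  simp; ring

/-- `1 + i ≠ 0`. [folklore] -/
lemma one_add_I_ne_zero : (1 : ℂ) + I ≠ 0 := by
  intro h; have := congrArg Complex.re h; simp at this

/-- **Residue theorem between two parallel lines of slope one.** Let `c₁ < c₂`, let `U` be an open
neighbourhood of the closed strip `{c₁ ≤ re z − im z ≤ c₂}` between the lines of slope one through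
`c₁` and `c₂`, `S` a finite subset of the open strip, `f` complex differentiable on `U ∖ S` with a
simple pole `f = φ_p/(z−p)` (`φ_p(p) = r p`) at each `p ∈ S`. If `u ↦ f(c_j + u(1+i))` is integrable
for `j = 1, 2` and `f(c + T(1+i)) → 0` as `|T| → ∞` uniformly in `c ∈ [c₁, c₂]`, then
`∫ f(c₂ + u(1+i)) du − ∫ f(c₁ + u(1+i)) du = (2πi/(1+i)) Σ_{p∈S} r(p)`
(right line minus left line, both traversed upwards; `dz = (1+i) du`). [folklore] -/
theorem integral_slant_sub_eq_sum_of_simplePoles {f : ℂ → ℂ} {c₁ c₂ : ℝ} (hc : c₁ < c₂)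
    (S : Finset ℂ) (r : ℂ → ℂ) (U : Set ℂ) (hU : IsOpen U)
    (hKU : {z : ℂ | z.re - z.im ∈ Icc c₁ c₂} ⊆ U) (hS : ∀ p ∈ S, p.re - p.im ∈ Ioo c₁ c₂)
    (hf : DifferentiableOn ℂ f (U \ ↑S))
    (hpole : ∀ p ∈ S, ∃ φ : ℂ → ℂ, ∃ V ∈ 𝓝 p, DifferentiableOn ℂ φ V ∧ φ p = r p ∧
        ∀ z ∈ V, z ≠ p → f z = φ z / (z - p))
    (h₁ : Integrable fun u : ℝ ↦ f (c₁ + u * (1 + I)))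
    (h₂ : Integrable fun u : ℝ ↦ f (c₂ + u * (1 + I)))
    (hdecay : ∀ ε : ℝ, 0 < ε → ∃ T₀ : ℝ, ∀ T : ℝ, T₀ ≤ |T| → ∀ c ∈ Icc c₁ c₂,
        ‖f (c + T * (1 + I))‖ ≤ ε) :
    (∫ u : ℝ, f (c₂ + u * (1 + I))) - ∫ u : ℝ, f (c₁ + u * (1 + I)) =
      2 * π * I / (1 + I) * ∑ p ∈ S, r p := by
  classical
  set e : ℂ := 1 + I with he
  have he0 : e ≠ 0 := one_add_I_ne_zero
  set F : ℂ → ℂ := fun w ↦ f (e * w) with hFdef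
  set y₁ : ℝ := -c₂ / 2 with hy₁
  set y₂ : ℝ := -c₁ / 2 with hy₂
  have hy : y₁ < y₂ := by rw [hy₁, hy₂]; linarith
  set S' : Finset ℂ := S.image (fun p ↦ p / e) with hS'
  set r' : ℂ → ℂ := fun q ↦ r (e * q) / e with hr'
  set U' : Set ℂ := (fun w ↦ e * w) ⁻¹' U with hU'
  have hU'open : IsOpen U' := hU.preimage (continuous_const.mul continuous_id)
  have hemul : ∀ q : ℂ, e * (q / e) = q := fun q ↦ mul_div_cancel₀ q he0
  -- geometry of the rotation
  have hstrip : ∀ w : ℂ, w.im ∈ Icc y₁ y₂ → (e * w).re - (e * w).im ∈ Icc c₁ c₂ := by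
    intro w hw
    rw [he, re_sub_im_one_add_I_mul]
    rw [hy₁, hy₂] at hw
    exact ⟨by linarith [hw.2], by linarith [hw.1]⟩
  have hKU' : im ⁻¹' Icc y₁ y₂ ⊆ U' := fun w hw ↦ hKU (hstrip w hw)
  have hS'mem : ∀ q ∈ S', e * q ∈ S := by
    intro q hq
    obtain ⟨p, hp, rfl⟩ := Finset.mem_image.1 hq
    rwa [hemul]
  have hS'im : ∀ q ∈ S', q.im ∈ Ioo y₁ y₂ := by
    intro q hq
    have h := hS (e * q) (hS'mem q hq)
    rw [he, re_sub_im_one_add_I_mul] at h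
    rw [hy₁, hy₂]
    exact ⟨by linarith [h.2], by linarith [h.1]⟩
  -- differentiability of `F` off `S'`
  have hOpen : IsOpen (U \ ↑S) := hU.sdiff (Finset.finite_toSet _).isClosed
  have hFd : DifferentiableOn ℂ F (U' \ ↑S') := by
    intro w hw
    have hw1 : e * w ∈ U := hw.1
    have hw2 : e * w ∉ (S : Set ℂ) := by
      intro h
      apply hw.2
      refine Finset.mem_coe.2 (Finset.mem_image.2 ⟨e * w, Finset.mem_coe.1 h, ?_⟩)
      field_simp
    have hfat : DifferentiableAt ℂ f (e * w) := hf.differentiableAt (hOpen.mem_nhds ⟨hw1, hw2⟩)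
    exact (hfat.comp w ((differentiableAt_id).const_mul e)).differentiableWithinAt
  -- simple poles of `F`
  have hpole' : ∀ q ∈ S', ∃ φ : ℂ → ℂ, ∃ V ∈ 𝓝 q, DifferentiableOn ℂ φ V ∧ φ q = r' q ∧
      ∀ z ∈ V, z ≠ q → F z = φ z / (z - q) := by
    intro q hq
    obtain ⟨φ, V, hV, hφd, hφp, hfφ⟩ := hpole (e * q) (hS'mem q hq)
    have hcont : ContinuousAt (fun w : ℂ ↦ e * w) q := (continuous_const.mul continuous_id).continuousAt
    refine ⟨fun w ↦ φ (e * w) / e, (fun w ↦ e * w) ⁻¹' V, hcont.preimage_mem_nhds hV, ?_, ?_, ?_⟩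
    · intro w hw
      have h1 : DifferentiableWithinAt ℂ φ V (e * w) := hφd (e * w) hw
      have h2 : DifferentiableWithinAt ℂ (fun w : ℂ ↦ e * w) ((fun w ↦ e * w) ⁻¹' V) w :=
        ((differentiableAt_id).const_mul e).differentiableWithinAt
      exact (h1.comp w h2 (fun z hz ↦ hz)).div_const e
    · simp only [hr', hφp]
    · intro z hz hzq
      have hne : e * z ≠ e * q := fun h ↦ hzq (mul_left_cancel₀ he0 h)
      have h := hfφ (e * z) hz hne
      simp only [hFdef, h]
      rw [← mul_sub]
      field_simp
  -- the two boundary lines of the horizontal strip are the two slanted lines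
  have hline : ∀ (c x : ℝ), F (x + ((-c / 2 : ℝ) : ℂ) * I) = f (c + ((x - c / 2 : ℝ) : ℂ) * (1 + I)) := by
    intro c x
    simp only [hFdef, he]
    rw [one_add_I_mul_ofReal_add_mul_I]
    congr 1
    push_cast
    ring
  have hint : ∀ c : ℝ, Integrable (fun u : ℝ ↦ f (c + u * (1 + I))) →
      Integrable fun x : ℝ ↦ F (x + ((-c / 2 : ℝ) : ℂ) * I) := by
    intro c hcint
    have h := hcint.comp_sub_right (c / 2)
    refine h.congr (Eventually.of_forall fun x ↦ ?_)
    simp only [hline]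
  have hI₁ : Integrable fun x : ℝ ↦ F (x + y₁ * I) := by rw [hy₁]; exact hint c₂ h₂
  have hI₂ : Integrable fun x : ℝ ↦ F (x + y₂ * I) := by rw [hy₂]; exact hint c₁ h₁
  -- decay on the far cross-sections
  have hdecay' : ∀ ε : ℝ, 0 < ε → ∃ T₀ : ℝ, ∀ T : ℝ, T₀ ≤ |T| → ∀ y ∈ Icc y₁ y₂,
      ‖F (T + y * I)‖ ≤ ε := by
    intro ε hε
    obtain ⟨T₀, hT₀⟩ := hdecay ε hε
    refine ⟨T₀ + (|y₁| + |y₂|), fun T hT y hyy ↦ ?_⟩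
    have hy_le : |y| ≤ |y₁| + |y₂| := by
      rcases le_or_gt 0 y with h0 | h0
      · rw [abs_of_nonneg h0]; linarith [hyy.2, le_abs_self y₂, abs_nonneg y₁]
      · rw [abs_of_neg h0]; linarith [hyy.1, neg_abs_le y₁, abs_nonneg y₂]
    have hTy : T₀ ≤ |T + y| := by
      have := abs_add_le (T + y) (-y)  -- |T| ≤ |T+y| + |y|
      simp only [add_neg_cancel_right, abs_neg] at this
      linarith
    have hcy : (-2 * y) ∈ Icc c₁ c₂ := by
      rw [hy₁, hy₂] at hyy
      exact ⟨by linarith [hyy.2], by linarith [hyy.1]⟩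
    have h := hT₀ (T + y) hTy (-2 * y) hcy
    simp only [hFdef, he]
    rw [one_add_I_mul_ofReal_add_mul_I]
    exact_mod_cast h
  -- apply the horizontal statement and translate back
  have hmain := integral_horizontal_sub_eq_sum_of_simplePoles hy S' r' U' hU'open hKU' hS'im hFd
    hpole' hI₁ hI₂ hdecay'
  have hL₁ : ∫ x : ℝ, F (x + y₁ * I) = ∫ u : ℝ, f (c₂ + u * (1 + I)) := by
    rw [hy₁]
    have h := integral_sub_right_eq_self (μ := volume) (fun u : ℝ ↦ f (c₂ + u * (1 + I))) (c₂ / 2)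
    rw [← h]
    refine integral_congr_ae (Eventually.of_forall fun x ↦ ?_)
    simp only [hline]
  have hL₂ : ∫ x : ℝ, F (x + y₂ * I) = ∫ u : ℝ, f (c₁ + u * (1 + I)) := by
    rw [hy₂]
    have h := integral_sub_right_eq_self (μ := volume) (fun u : ℝ ↦ f (c₁ + u * (1 + I))) (c₁ / 2)
    rw [← h]
    refine integral_congr_ae (Eventually.of_forall fun x ↦ ?_)
    simp only [hline]
  have hsum : ∑ q ∈ S', r' q = (∑ p ∈ S, r p) / e := by
    rw [hS', Finset.sum_image (fun p _ q _ h ↦ by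
      have := congrArg (fun z ↦ e * z) h; simpa only [hemul] using this)]
    rw [Finset.sum_div]
    refine Finset.sum_congr rfl fun p _ ↦ ?_
    simp only [hr', hemul]
  rw [hL₁, hL₂, hsum] at hmain
  rw [hmain, he]
  field_simp

/-! ### Poles at the zeros of `sin (π z)` -/

/-- `sin (π z) = 0` iff `z` is an integer. [folklore] -/
lemma sin_pi_mul_eq_zero_iff (z : ℂ) : Complex.sin (π * z) = 0 ↔ ∃ n : ℤ, z = n := by
  rw [Complex.sin_eq_zero_iff]
  have hπ : (π : ℂ) ≠ 0 := ofReal_ne_zero.2 Real.pi_ne_zero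
  constructor
  · rintro ⟨n, hn⟩
    exact ⟨n, by
      have : (π : ℂ) * z = π * n := by rw [hn]; ring
      exact mul_left_cancel₀ hπ this⟩
  · rintro ⟨n, rfl⟩
    exact ⟨n, by ring⟩

/-- `cos (n π) = (-1)ⁿ` for complex cosine and an integer `n`. [folklore] -/
lemma cos_int_mul_pi_complex (n : ℤ) : Complex.cos (n * π) = (-1) ^ n := by
  have h : Complex.cos (n * π) = ((Real.cos (n * π) : ℝ) : ℂ) := by
    rw [Complex.ofReal_cos]; push_cast; rfl
  rw [h, Real.cos_int_mul_pi]; push_cast; rfl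

/-- The derivative of `z ↦ sin (π z)` at an integer `n` is `π (-1)ⁿ ≠ 0`. [folklore] -/
lemma hasDerivAt_sin_pi_mul_int (n : ℤ) :
    HasDerivAt (fun z : ℂ ↦ Complex.sin (π * z)) (π * (-1) ^ n) (n : ℂ) := by
  have h : HasDerivAt (fun z : ℂ ↦ Complex.sin (π * z)) (Complex.cos (π * n) * (π * 1)) (n : ℂ) :=
    (Complex.hasDerivAt_sin (π * n)).comp (n : ℂ) ((hasDerivAt_id (n : ℂ)).const_mul (π : ℂ))
  have hcos : Complex.cos (π * n) = (-1) ^ n := by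
    rw [mul_comm]
    exact cos_int_mul_pi_complex n
  rw [hcos] at h
  convert h using 1
  ring

/-- **Residue theorem between two lines of slope one, for `h(z)/sin(πz)`.** Let `c₁ < c₂` be real
non-integers, `U` an open neighbourhood of the closed strip `{c₁ ≤ re z − im z ≤ c₂}` and `h`
complex differentiable on `U`. Put `f = h / sin(π ·)`; its poles in the strip are the integers
`n ∈ (c₁, c₂)`, simple, with residues `(-1)ⁿ h(n)/π`. If `u ↦ f(c_j + u(1+i))` is integrable
(`j = 1,2`) and `f(c + T(1+i)) → 0` as `|T| → ∞` uniformly in `c ∈ [c₁,c₂]`, then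
`∫ f(c₂ + u(1+i)) du − ∫ f(c₁ + u(1+i)) du = (2i/(1+i)) Σ_{c₁ < n < c₂} (-1)ⁿ h(n)`. [folklore] -/
theorem integral_slant_div_sin_sub_eq_sum {h : ℂ → ℂ} {c₁ c₂ : ℝ} (hc : c₁ < c₂)
    (hc₁ : ∀ n : ℤ, (n : ℝ) ≠ c₁) (hc₂ : ∀ n : ℤ, (n : ℝ) ≠ c₂)
    (U : Set ℂ) (hU : IsOpen U) (hKU : {z : ℂ | z.re - z.im ∈ Icc c₁ c₂} ⊆ U)
    (hh : DifferentiableOn ℂ h U)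
    (h₁ : Integrable fun u : ℝ ↦ h (c₁ + u * (1 + I)) / Complex.sin (π * (c₁ + u * (1 + I))))
    (h₂ : Integrable fun u : ℝ ↦ h (c₂ + u * (1 + I)) / Complex.sin (π * (c₂ + u * (1 + I))))
    (hdecay : ∀ ε : ℝ, 0 < ε → ∃ T₀ : ℝ, ∀ T : ℝ, T₀ ≤ |T| → ∀ c ∈ Icc c₁ c₂,
        ‖h (c + T * (1 + I)) / Complex.sin (π * (c + T * (1 + I)))‖ ≤ ε) :
    (∫ u : ℝ, h (c₂ + u * (1 + I)) / Complex.sin (π * (c₂ + u * (1 + I))))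
      - ∫ u : ℝ, h (c₁ + u * (1 + I)) / Complex.sin (π * (c₁ + u * (1 + I))) =
      2 * I / (1 + I) * ∑ n ∈ Finset.Ioc ⌊c₁⌋ ⌊c₂⌋, (-1) ^ n * h n := by
  classical
  set g : ℂ → ℂ := fun z ↦ Complex.sin (π * z) with hg
  set f : ℂ → ℂ := fun z ↦ h z / g z with hf
  -- the poles
  set S : Finset ℂ := (Finset.Ioc ⌊c₁⌋ ⌊c₂⌋).image (fun n : ℤ ↦ (n : ℂ)) with hSdef
  set r : ℂ → ℂ := fun p ↦ h p / (π * Complex.cos (π * p)) with hr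
  -- integers strictly between `c₁` and `c₂`
  have hIoc : ∀ n : ℤ, n ∈ Finset.Ioc ⌊c₁⌋ ⌊c₂⌋ ↔ c₁ < n ∧ (n : ℝ) < c₂ := by
    intro n
    rw [Finset.mem_Ioc, Int.floor_lt, Int.le_floor]
    constructor
    · rintro ⟨h1, h2⟩
      exact ⟨h1, lt_of_le_of_ne h2 (hc₂ n)⟩
    · rintro ⟨h1, h2⟩
      exact ⟨h1, h2.le⟩
  -- a slightly larger open strip free of other integers
  obtain ⟨c₁', hc₁'1, hc₁'2⟩ : ∃ c₁' : ℝ, c₁' < c₁ ∧ ∀ n : ℤ, c₁' < n → c₁ < n := by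
    refine ⟨(⌊c₁⌋ + c₁) / 2, ?_, fun n hn ↦ ?_⟩
    · have h1 : (⌊c₁⌋ : ℝ) ≤ c₁ := Int.floor_le c₁
      have h2 : (⌊c₁⌋ : ℝ) ≠ c₁ := hc₁ _
      have h3 : (⌊c₁⌋ : ℝ) < c₁ := lt_of_le_of_ne h1 h2
      linarith
    · have h1 : (⌊c₁⌋ : ℝ) ≤ c₁ := Int.floor_le c₁
      have h4 : (⌊c₁⌋ : ℝ) < n := by linarith
      have h5 : ⌊c₁⌋ < n := by exact_mod_cast h4
      have h6 : ⌊c₁⌋ + 1 ≤ n := h5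
      have h7 : c₁ < (⌊c₁⌋ : ℝ) + 1 := Int.lt_floor_add_one c₁
      have h8 : ((⌊c₁⌋ + 1 : ℤ) : ℝ) ≤ n := by exact_mod_cast h6
      push_cast at h8
      linarith
  obtain ⟨c₂', hc₂'1, hc₂'2⟩ : ∃ c₂' : ℝ, c₂ < c₂' ∧ ∀ n : ℤ, (n : ℝ) < c₂' → (n : ℝ) < c₂ := by
    refine ⟨(⌊c₂⌋ + 1 + c₂) / 2, ?_, fun n hn ↦ ?_⟩
    · have h7 : c₂ < (⌊c₂⌋ : ℝ) + 1 := Int.lt_floor_add_one c₂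
      linarith
    · have h7 : c₂ < (⌊c₂⌋ : ℝ) + 1 := Int.lt_floor_add_one c₂
      have h4 : (n : ℝ) < ⌊c₂⌋ + 1 := by linarith
      have h5 : n < ⌊c₂⌋ + 1 := by exact_mod_cast h4
      have h6 : n ≤ ⌊c₂⌋ := Int.lt_add_one_iff.1 h5
      have h8 : (n : ℝ) ≤ ⌊c₂⌋ := by exact_mod_cast h6
      have h1 : (⌊c₂⌋ : ℝ) ≤ c₂ := Int.floor_le c₂
      exact lt_of_le_of_ne (h8.trans h1) (hc₂ n)
  set W : Set ℂ := {z : ℂ | z.re - z.im ∈ Ioo c₁' c₂'} with hW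
  have hWopen : IsOpen W :=
    isOpen_Ioo.preimage (Complex.continuous_re.sub Complex.continuous_im)
  set U₀ : Set ℂ := U ∩ W with hU₀
  have hU₀open : IsOpen U₀ := hU.inter hWopen
  have hKU₀ : {z : ℂ | z.re - z.im ∈ Icc c₁ c₂} ⊆ U₀ := fun z hz ↦
    ⟨hKU hz, ⟨hc₁'1.trans_le hz.1, hz.2.trans_lt hc₂'1⟩⟩
  -- zeros of `g` in `U₀` are the poles
  have hgzero : ∀ z ∈ U₀, g z = 0 → z ∈ (S : Set ℂ) := by
    intro z hz hgz
    obtain ⟨n, rfl⟩ := (sin_pi_mul_eq_zero_iff z).1 hgz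
    have hzW := hz.2
    simp only [hW, mem_setOf_eq, Complex.intCast_re, Complex.intCast_im, sub_zero] at hzW
    refine Finset.mem_coe.2 (Finset.mem_image.2 ⟨n, (hIoc n).2 ⟨hc₁'2 n hzW.1, hc₂'2 n hzW.2⟩, rfl⟩)
  have hgd : Differentiable ℂ g := fun z ↦
    ((Complex.hasDerivAt_sin (π * z)).comp z ((hasDerivAt_id z).const_mul (π : ℂ))).differentiableAt
  have hfd : DifferentiableOn ℂ f (U₀ \ ↑S) := by
    intro z hz
    have hgz : g z ≠ 0 := fun h0 ↦ hz.2 (hgzero z hz.1 h0)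
    exact ((hh z hz.1.1).mono (fun w hw ↦ hw.1.1)).div (hgd z).differentiableWithinAt hgz
  have hSmem : ∀ p ∈ S, p.re - p.im ∈ Ioo c₁ c₂ := by
    intro p hp
    obtain ⟨n, hn, rfl⟩ := Finset.mem_image.1 hp
    simpa using (hIoc n).1 hn
  -- simple poles: `f = (h / dslope g n) / (z - n)` near an integer `n`
  have hpole : ∀ p ∈ S, ∃ φ : ℂ → ℂ, ∃ V ∈ 𝓝 p, DifferentiableOn ℂ φ V ∧ φ p = r p ∧
      ∀ z ∈ V, z ≠ p → f z = φ z / (z - p) := by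
    intro p hp
    obtain ⟨n, hn, rfl⟩ := Finset.mem_image.1 hp
    have hder : HasDerivAt g (π * (-1) ^ n) (n : ℂ) := hasDerivAt_sin_pi_mul_int n
    have hgn : g n = 0 := (sin_pi_mul_eq_zero_iff _).2 ⟨n, rfl⟩
    have hdsn : dslope g n n = π * (-1) ^ n := by rw [dslope_same, hder.deriv]
    have hne : dslope g n n ≠ 0 := by
      rw [hdsn]
      exact mul_ne_zero (ofReal_ne_zero.2 Real.pi_ne_zero) (zpow_ne_zero _ (by norm_num))
    have hcont : ContinuousAt (dslope g n) n := continuousAt_dslope_same.2 (hgd n)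
    -- an open neighbourhood of `n` inside `U₀` where `dslope g n ≠ 0`
    obtain ⟨V, hVmem, hVopen, hVsub⟩ : ∃ V : Set ℂ, (n : ℂ) ∈ V ∧ IsOpen V ∧
        V ⊆ U₀ ∩ {z | dslope g n z ≠ 0} := by
      have h1 : U₀ ∩ {z | dslope g n z ≠ 0} ∈ 𝓝 (n : ℂ) := by
        refine inter_mem (hU₀open.mem_nhds (hKU₀ ?_)) (hcont.preimage_mem_nhds (isOpen_ne.mem_nhds hne))
        have := hSmem n hp
        exact ⟨this.1.le, this.2.le⟩
      obtain ⟨V, hV1, hV2, hV3⟩ := mem_nhds_iff.1 h1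
      exact ⟨V, hV3, hV2, hV1⟩
    refine ⟨fun z ↦ h z / dslope g n z, V, hVopen.mem_nhds hVmem, ?_, ?_, ?_⟩
    · have hdsd : DifferentiableOn ℂ (dslope g n) V :=
        (differentiableOn_dslope (hVopen.mem_nhds hVmem)).2 (hgd.differentiableOn)
      exact (hh.mono fun z hz ↦ (hVsub hz).1.1).div hdsd fun z hz ↦ (hVsub hz).2
    · simp only [hr, hdsn]
      rw [mul_comm (π : ℂ) ((n : ℤ) : ℂ), cos_int_mul_pi_complex n]
    · intro z hz hzn
      have hds : dslope g n z = g z / (z - n) := by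
        rw [dslope_of_ne _ hzn, slope_def_field, hgn, sub_zero]
      simp only [hf, hds]
      have hzn' : z - n ≠ 0 := sub_ne_zero.2 hzn
      have hgz : g z ≠ 0 := by
        intro h0
        have := (hVsub hz).2
        simp only [mem_setOf_eq, hds, h0, zero_div, ne_eq, not_true_eq_false] at this
      field_simp
  have hmain := integral_slant_sub_eq_sum_of_simplePoles hc S r U₀ hU₀open hKU₀ hSmem hfd hpole
    h₁ h₂ hdecay
  rw [hmain, hSdef, Finset.sum_image (fun m _ n _ h ↦ by exact_mod_cast h)]
  have hπ : (π : ℂ) ≠ 0 := ofReal_ne_zero.2 Real.pi_ne_zero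
  rw [Finset.mul_sum, Finset.mul_sum]
  refine Finset.sum_congr rfl fun n _ ↦ ?_
  simp only [hr]
  rw [mul_comm (π : ℂ) ((n : ℤ) : ℂ), cos_int_mul_pi_complex n]
  have hu : ((-1 : ℂ) ^ n) * ((-1 : ℂ) ^ n) = 1 := by
    rw [← mul_zpow, neg_one_mul, neg_neg, one_zpow]
  have hu0 : ((-1 : ℂ) ^ n) ≠ 0 := zpow_ne_zero _ (by norm_num)
  have he0 : (1 : ℂ) + I ≠ 0 := one_add_I_ne_zero
  have key : h n / (π * (-1) ^ n) = (-1) ^ n * h n / π := by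
    rw [div_eq_div_iff (mul_ne_zero hπ hu0) hπ]
    linear_combination (-(π * h n)) * hu
  rw [key]
  field_simp

/-! ### Functions merely continuous up to the boundary of the strip -/

/-- **Pole-free horizontal shift, boundary-continuous version.** As
`Literature.Analysis.Complex.integral_horizontal_eq_of_differentiableOn`, but it suffices that `F` be
continuous on the closed strip `y₁ ≤ im w ≤ y₂` and complex differentiable on the open strip
`y₁ < im w < y₂` (Cauchy–Goursat in Mathlib's boundary-continuous form
`Complex.integral_boundary_rect_eq_zero_of_continuousOn_of_differentiableOn`). This is the form
needed to push a line of integration onto a line passing through an integrable algebraic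
singularity of the integrand. [folklore] -/
theorem integral_horizontal_eq_of_continuousOn_of_differentiableOn {F : ℂ → ℂ} {y₁ y₂ : ℝ}
    (hy : y₁ ≤ y₂) (hFc : ContinuousOn F (im ⁻¹' Icc y₁ y₂))
    (hFd : DifferentiableOn ℂ F (im ⁻¹' Ioo y₁ y₂))
    (h₁ : Integrable fun x : ℝ ↦ F (x + y₁ * I)) (h₂ : Integrable fun x : ℝ ↦ F (x + y₂ * I))
    (hdecay : ∀ ε : ℝ, 0 < ε → ∃ T₀ : ℝ, ∀ T : ℝ, T₀ ≤ |T| → ∀ y ∈ Icc y₁ y₂,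
        ‖F (T + y * I)‖ ≤ ε) :
    ∫ x : ℝ, F (x + y₁ * I) = ∫ x : ℝ, F (x + y₂ * I) := by
  -- the rectangle identity for `T > 0`
  have hrect : ∀ T : ℝ, 0 < T → rectBoundaryIntegral F (-T) T y₁ y₂ = 0 := by
    intro T hT
    have h := Complex.integral_boundary_rect_eq_zero_of_continuousOn_of_differentiableOn F
      ((-T : ℝ) + y₁ * I) (T + y₂ * I) ?_ ?_
    · simp only [add_re, ofReal_re, mul_re, I_re, mul_zero, ofReal_im, I_im, mul_one, sub_self,
        add_zero, add_im, mul_im, zero_add, smul_eq_mul] at h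
      simpa [rectBoundaryIntegral] using h
    · refine hFc.mono fun z hz ↦ ?_
      rw [mem_reProdIm] at hz
      simp only [add_im, ofReal_im, mul_im, ofReal_re, I_im, mul_one, I_re, mul_zero, add_zero,
        zero_add, uIcc_of_le hy] at hz
      exact hz.2
    · refine hFd.mono fun z hz ↦ ?_
      rw [mem_reProdIm] at hz
      simp only [add_im, ofReal_im, mul_im, ofReal_re, I_im, mul_one, I_re, mul_zero, add_zero,
        zero_add, min_eq_left hy, max_eq_right hy] at hz
      exact hz.2
  -- the horizontal sides converge to the full line integrals
  have hbot : Tendsto (fun T : ℝ ↦ ∫ x in (-T)..T, F (x + y₁ * I)) atTop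
      (𝓝 (∫ x : ℝ, F (x + y₁ * I))) :=
    intervalIntegral_tendsto_integral h₁ tendsto_neg_atTop_atBot tendsto_id
  have htop : Tendsto (fun T : ℝ ↦ ∫ x in (-T)..T, F (x + y₂ * I)) atTop
      (𝓝 (∫ x : ℝ, F (x + y₂ * I))) :=
    intervalIntegral_tendsto_integral h₂ tendsto_neg_atTop_atBot tendsto_id
  -- the vertical sides tend to zero
  have hvert : Tendsto (fun T : ℝ ↦ I * (∫ y in y₁..y₂, F (T + y * I))
      - I * (∫ y in y₁..y₂, F (((-T : ℝ) : ℂ) + y * I))) atTop (𝓝 0) := by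
    rw [Metric.tendsto_atTop]
    intro ε hε
    set ε' : ℝ := ε / (2 * (y₂ - y₁) + 1) with hε'
    have hba : 0 ≤ y₂ - y₁ := by linarith
    have hε'0 : 0 < ε' := div_pos hε (by positivity)
    obtain ⟨T₀, hT₀⟩ := hdecay ε' hε'0
    refine ⟨max T₀ 0, fun T hT ↦ ?_⟩
    have hT0 : 0 ≤ T := le_of_max_le_right hT
    have hTabs : T₀ ≤ |T| := by rw [abs_of_nonneg hT0]; exact le_of_max_le_left hT
    have hTabs' : T₀ ≤ |(-T)| := by rwa [abs_neg]
    have hr : ‖∫ y in y₁..y₂, F (T + y * I)‖ ≤ ε' * |y₂ - y₁| :=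
      norm_integral_le_of_norm_le_const fun y hyy ↦
        hT₀ T hTabs y (by rw [uIoc_of_le hy] at hyy; exact ⟨hyy.1.le, hyy.2⟩)
    have hl : ‖∫ y in y₁..y₂, F (((-T : ℝ) : ℂ) + y * I)‖ ≤ ε' * |y₂ - y₁| :=
      norm_integral_le_of_norm_le_const fun y hyy ↦
        hT₀ (-T) hTabs' y (by rw [uIoc_of_le hy] at hyy; exact ⟨hyy.1.le, hyy.2⟩)
    rw [abs_of_nonneg hba] at hr hl
    rw [dist_zero_right, ← mul_sub, norm_mul, Complex.norm_I, one_mul]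
    calc ‖(∫ y in y₁..y₂, F (T + y * I)) - ∫ y in y₁..y₂, F (((-T : ℝ) : ℂ) + y * I)‖
        ≤ ε' * (y₂ - y₁) + ε' * (y₂ - y₁) := (norm_sub_le _ _).trans (add_le_add hr hl)
      _ < ε := by
          have : ε' * (2 * (y₂ - y₁) + 1) = ε := by rw [hε']; field_simp
          nlinarith
  have hlim : Tendsto (fun T : ℝ ↦ rectBoundaryIntegral F (-T) T y₁ y₂) atTop
      (𝓝 ((∫ x : ℝ, F (x + y₁ * I)) - (∫ x : ℝ, F (x + y₂ * I)) + 0)) := by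
    refine ((hbot.sub htop).add hvert).congr' (Eventually.of_forall fun T ↦ ?_)
    simp only [rectBoundaryIntegral]
    ring
  have hconst : Tendsto (fun T : ℝ ↦ rectBoundaryIntegral F (-T) T y₁ y₂) atTop (𝓝 0) := by
    refine tendsto_const_nhds.congr' ?_
    filter_upwards [eventually_gt_atTop 0] with T hT
    exact (hrect T hT).symm
  have h := tendsto_nhds_unique hlim hconst
  rw [add_zero] at h
  exact sub_eq_zero.1 h

/-- **Pole-free shift between two lines of slope one, boundary-continuous version.** Let
`c₁ ≤ c₂`, `f` continuous on the closed strip `{c₁ ≤ re z − im z ≤ c₂}` and complex differentiable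
on the open strip `{c₁ < re z − im z < c₂}`. If `u ↦ f(c_j + u(1+i))` is integrable (`j = 1, 2`)
and `f(c + T(1+i)) → 0` as `|T| → ∞` uniformly in `c ∈ [c₁, c₂]`, then
`∫ f(c₂ + u(1+i)) du = ∫ f(c₁ + u(1+i)) du`. [folklore] -/
theorem integral_slant_eq_of_continuousOn_of_differentiableOn {f : ℂ → ℂ} {c₁ c₂ : ℝ}
    (hc : c₁ ≤ c₂) (hfc : ContinuousOn f {z : ℂ | z.re - z.im ∈ Icc c₁ c₂})
    (hfd : DifferentiableOn ℂ f {z : ℂ | z.re - z.im ∈ Ioo c₁ c₂})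
    (h₁ : Integrable fun u : ℝ ↦ f (c₁ + u * (1 + I)))
    (h₂ : Integrable fun u : ℝ ↦ f (c₂ + u * (1 + I)))
    (hdecay : ∀ ε : ℝ, 0 < ε → ∃ T₀ : ℝ, ∀ T : ℝ, T₀ ≤ |T| → ∀ c ∈ Icc c₁ c₂,
        ‖f (c + T * (1 + I))‖ ≤ ε) :
    ∫ u : ℝ, f (c₂ + u * (1 + I)) = ∫ u : ℝ, f (c₁ + u * (1 + I)) := by
  set e : ℂ := 1 + I with he
  set F : ℂ → ℂ := fun w ↦ f (e * w) with hFdef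
  set y₁ : ℝ := -c₂ / 2 with hy₁
  set y₂ : ℝ := -c₁ / 2 with hy₂
  have hy : y₁ ≤ y₂ := by rw [hy₁, hy₂]; linarith
  have hcont_e : Continuous fun w : ℂ ↦ e * w := continuous_const.mul continuous_id
  -- geometry of the rotation
  have hstripc : ∀ w : ℂ, w.im ∈ Icc y₁ y₂ → (e * w).re - (e * w).im ∈ Icc c₁ c₂ := by
    intro w hw
    rw [he, re_sub_im_one_add_I_mul]
    rw [hy₁, hy₂] at hw
    exact ⟨by linarith [hw.2], by linarith [hw.1]⟩
  have hstripo : ∀ w : ℂ, w.im ∈ Ioo y₁ y₂ → (e * w).re - (e * w).im ∈ Ioo c₁ c₂ := by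
    intro w hw
    rw [he, re_sub_im_one_add_I_mul]
    rw [hy₁, hy₂] at hw
    exact ⟨by linarith [hw.2], by linarith [hw.1]⟩
  have hFc : ContinuousOn F (im ⁻¹' Icc y₁ y₂) :=
    hfc.comp hcont_e.continuousOn fun w hw ↦ hstripc w hw
  have hFd : DifferentiableOn ℂ F (im ⁻¹' Ioo y₁ y₂) :=
    hfd.comp ((differentiable_id.const_mul e).differentiableOn) fun w hw ↦ hstripo w hw
  -- the two boundary lines of the horizontal strip are the two slanted lines
  have hline : ∀ (c x : ℝ), F (x + ((-c / 2 : ℝ) : ℂ) * I) =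
      f (c + ((x - c / 2 : ℝ) : ℂ) * (1 + I)) := by
    intro c x
    simp only [hFdef, he]
    rw [one_add_I_mul_ofReal_add_mul_I]
    congr 1
    push_cast
    ring
  have hint : ∀ c : ℝ, Integrable (fun u : ℝ ↦ f (c + u * (1 + I))) →
      Integrable fun x : ℝ ↦ F (x + ((-c / 2 : ℝ) : ℂ) * I) := by
    intro c hcint
    have h := hcint.comp_sub_right (c / 2)
    refine h.congr (Eventually.of_forall fun x ↦ ?_)
    simp only [hline]
  have hI₁ : Integrable fun x : ℝ ↦ F (x + y₁ * I) := by rw [hy₁]; exact hint c₂ h₂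
  have hI₂ : Integrable fun x : ℝ ↦ F (x + y₂ * I) := by rw [hy₂]; exact hint c₁ h₁
  -- decay on the far cross-sections
  have hdecay' : ∀ ε : ℝ, 0 < ε → ∃ T₀ : ℝ, ∀ T : ℝ, T₀ ≤ |T| → ∀ y ∈ Icc y₁ y₂,
      ‖F (T + y * I)‖ ≤ ε := by
    intro ε hε
    obtain ⟨T₀, hT₀⟩ := hdecay ε hε
    refine ⟨T₀ + (|y₁| + |y₂|), fun T hT y hyy ↦ ?_⟩
    have hy_le : |y| ≤ |y₁| + |y₂| := by
      rcases le_or_gt 0 y with h0 | h0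
      · rw [abs_of_nonneg h0]; linarith [hyy.2, le_abs_self y₂, abs_nonneg y₁]
      · rw [abs_of_neg h0]; linarith [hyy.1, neg_abs_le y₁, abs_nonneg y₂]
    have hTy : T₀ ≤ |T + y| := by
      have := abs_add_le (T + y) (-y)
      simp only [add_neg_cancel_right, abs_neg] at this
      linarith
    have hcy : (-2 * y) ∈ Icc c₁ c₂ := by
      rw [hy₁, hy₂] at hyy
      exact ⟨by linarith [hyy.2], by linarith [hyy.1]⟩
    have h := hT₀ (T + y) hTy (-2 * y) hcy
    simp only [hFdef, he]
    rw [one_add_I_mul_ofReal_add_mul_I]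
    exact_mod_cast h
  have hmain := integral_horizontal_eq_of_continuousOn_of_differentiableOn hy hFc hFd hI₁ hI₂
    hdecay'
  have hL₁ : ∫ x : ℝ, F (x + y₁ * I) = ∫ u : ℝ, f (c₂ + u * (1 + I)) := by
    rw [hy₁]
    have h := integral_sub_right_eq_self (μ := volume) (fun u : ℝ ↦ f (c₂ + u * (1 + I))) (c₂ / 2)
    rw [← h]
    refine integral_congr_ae (Eventually.of_forall fun x ↦ ?_)
    simp only [hline]
  have hL₂ : ∫ x : ℝ, F (x + y₂ * I) = ∫ u : ℝ, f (c₁ + u * (1 + I)) := by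
    rw [hy₂]
    have h := integral_sub_right_eq_self (μ := volume) (fun u : ℝ ↦ f (c₁ + u * (1 + I))) (c₁ / 2)
    rw [← h]
    refine integral_congr_ae (Eventually.of_forall fun x ↦ ?_)
    simp only [hline]
  rw [← hL₁, ← hL₂, hmain]

end Literature.Analysis.Complex
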